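import Summits.QuantumFields.BalabanUV.Beta.RemainderExplicitHistoryLogMomentSharp

/-!
# RemainderExplicitHistoryLogMomentScaleSharp — ROAD P3, A PER-SCALE LOG-MOMENT DOES NOT BUY THE ENVELOPE: an ADAPTIVE family with
# per-scale logarithmic age-moment EXACTLY `M` at every scale whose two-loop envelope grows like `log log K` along an unbounded set
# of run lengths (`RemainderExplicitHistoryLogMomentScale`'s `O(log log K)` is SHARP; `…Value`'s VALUE is all a per-scale bound buys)

Cell `pub-balaban`, β-function sub-cell, BINDER row D4 «RemainderConst leaves for Bałaban's split» (owner lineage `b2b-balaban-beta-an4`;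
this file by co-owner #3 lineage `b2b-balaban-beta-d4-p3`, road P3, generation 43, station S-d4p3-g43-1, seventh file; imports
`RemainderExplicitHistoryLogMomentSharp`), β-FLOW TEAM duty (1); FREEZE (0) honoured (def-free module in road P3's own `RemainderExplicit*`
series; no leaf, no interface, no Literature file).  SOURCE OF THE SHAPES ONLY: [Balaban1987RG1] (0.20) p. 256, Thm 2 p. 259, §5 p. 298.
HONEST FRAMING (page 1 of everything the β sub-cell writes).  *"Discharging BetaPertH makes Bałaban's UV stability UNCONDITIONAL — a
real constructive-QFT result; it is NOT the continuum limit and NOT the Clay problem."*  THIS FILE DISCHARGES NOTHING OF THE KIND: it is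
elementary real analysis about ONE explicit toy family (ours).  THE ADAPTIVE FAMILY: `β_{k+1}(p) = b + p_k·w_k·(p_k − p_{k − a(k)})`,
`w_k = M∕(1 + log(1 + a(k)))`, written as the witness file's weighted family with `λ k i = w_k·[i = k − a(k)]` and carried as a HYPOTHESIS
`hβ` (def-free); the AGE MAP `a : ℕ → ℕ` is a hypothesis too, asked to equal `K − k` on the upper half `K ≤ 2k < 2K` of every run length
`K` in an unbounded set (`age_map_exists`: `a(k) = 2^{⌊log₂ k⌋+1} − k`, the powers of 2).  Its per-scale log-moment is EXACTLY `M` at every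
scale (`scaleLogMoment_eq`), so `RemainderExplicitHistoryLogMomentScale` ∕ `…Value` apply (value = the diagonal's, envelope `O(log log K)`);
THIS FILE shows the envelope IS unbounded.  Nothing of Bałaban's (1.22) is asserted or constructed; row D4 class UNCHANGED (critical-path
width 0; instance 0∕1; D4 DISCHARGE NO DATE); NOT B12 Thm 2, NOT BetaPertH, NOT continuum, NOT Clay.  HONEST DEPENDENCY: continuum YM
on T⁴ ⇐ BetaPertH ∧ nine spine estimates (0/9 proved); BetaPertH ⇐ (D1) ∧ (D4) ∧ CAP+tail; G-an2-4 gates asym, D1 and NE2/3/4.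
ABSOLUTE RULE: nothing is cited as a fact; the family is ours and explicit.

WHAT IS PROVED ([folklore]; 0 sorry; 0 `def`).  §1 the point weights: `sum_pointWeight`, `sum_pointWeight_sub`, `pointWeight_nonneg`,
`sum_pointWeight_le` (total weight `w_k ≤ M`), **`scaleLogMoment_eq`** (`Σ_i λ k i·(1 + log(1 + (k − i))) = M` at every scale).  §2 the lower
iterated logarithm: `logWeight_sub_le_inv_mul` (`log(1 + log(x+1)) − log(1 + log x) ≤ 1∕(x(1 + log x))`, twice `log y ≤ y − 1`),
`sum_inv_mul_logWeight_ge`.  §3 the deviation: `beta1_prefix_nonneg`, `beta1_prefix_ge_adaptive` (on the upper half of a run of a selected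
length `β¹_k(prefix) ≥ (M∕24)∕((P + β′m)(1 + log(1 + m)))`, `m = K − k`, `β′m ≥ P = 1∕g_K²`, `β′ = 3b∕2` — the witness file's `run_sub_ge` ∕
`run_sq_ge`), **`deviation_ge_loglog`** (`1∕g_0² − 1∕g_K² − Kb ≥ (M∕(36b))·(log(1 + log(P∕β′ + 1 + ⌊K∕2⌋ + 1)) − log(1 + log(P∕β′ + 1 + m₀)))`).
§4 END **`scaleLogMoment_not_sufficient_for_envelope`**: for the adaptive family (`b, M > 0`, `γ > 0`, `2Mγ² ≤ b`) and every `g ∈ ]0,γ]`,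
NO `K`-uniform bound `|1∕(gs 0)² − 1∕g² − K·b| ≤ Q′` over its runs ending at `g`; `age_map_exists`.  READING (sense (α)): both thresholds
of the station at (AF-1)'s order are exact — PROFILE log-moment ⟺ envelope (files A, D, E); PER-SCALE log-moment ⟹ value and NOT
envelope (files B, C, this file).  All letters NOT-IN-PRINT; no junction of `BetaFlowAsPrinted` changes.
-/

noncomputable section

open Finset Filter Topology

namespace Summit.QuantumFields.BalabanUV.Beta.RemainderExplicitHistoryLogMomentScaleSharp

open Literature.MathematicalPhysics.QuantumFieldTheory.Balaban1983to89
open Literature.MathematicalPhysics.QuantumFieldTheory.Balaban1983to89.FlowStep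
open Literature.MathematicalPhysics.QuantumFieldTheory.Balaban1983to89.T4CouplingMatching
open Summit.QuantumFields.BalabanUV.Beta.EriceRemainderEnclosureHistoryTwoLoop
open Summit.QuantumFields.BalabanUV.Beta.RemainderExplicitHistoryLogMomentWitness
open Summit.QuantumFields.BalabanUV.Beta.RemainderExplicitHistoryLogMomentSharp (deviation_eq)

variable {β : HBeta} {b γ M : ℝ} {a : ℕ → ℕ}

/-! ## §1 The adaptive point weights `λ k i = w_k·[i = k − a(k)]`, `w_k = M∕(1 + log(1 + a(k)))` -/

/-- A point weight at the admissible index `k − a(k) ≤ k` sums to its value over `Fin (k+1)`. [folklore] -/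
theorem sum_pointWeight (k c : ℕ) (hc : c ≤ k) (w : ℝ) (f : ℕ → ℝ) :
    ∑ i : Fin (k + 1), (if (i : ℕ) = c then w else 0) * f i = w * f c := by
  rw [Fin.sum_univ_eq_sum_range (fun i : ℕ => (if i = c then w else 0) * f i) (k + 1)]
  rw [Finset.sum_eq_single_of_mem c (mem_range.2 (Nat.lt_succ_of_le hc))]
  · simp
  · intro j _ hj; simp [hj]

/-- The same against a difference `x − g i` (the shape of the family's history term along a run). [folklore] -/
theorem sum_pointWeight_sub (k c : ℕ) (hc : c ≤ k) (w x : ℝ) (g : ℕ → ℝ) :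
    ∑ i : Fin (k + 1), (if (i : ℕ) = c then w else 0) * (x - g i) = w * (x - g c) :=
  sum_pointWeight k c hc w (fun j => x - g j)

/-- THE WEIGHT IS NON-NEGATIVE (`M ≥ 0`). [folklore] -/
theorem pointWeight_nonneg (hM : 0 ≤ M) (k : ℕ) (i : Fin (k + 1)) :
    0 ≤ (if (i : ℕ) = k - a k then M / (1 + Real.log (1 + (a k : ℝ))) else 0) := by
  split_ifs
  · have : 0 ≤ Real.log (1 + (a k : ℝ)) := Real.log_nonneg (by linarith [Nat.cast_nonneg (α := ℝ) (a k)])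
    positivity
  · exact le_rfl

/-- THE TOTAL WEIGHT OF ONE SCALE IS `w_k ≤ M`. [folklore] -/
theorem sum_pointWeight_le (hM : 0 ≤ M) (k : ℕ) :
    ∑ i : Fin (k + 1), (if (i : ℕ) = k - a k then M / (1 + Real.log (1 + (a k : ℝ))) else 0) ≤ M := by
  have h := sum_pointWeight k (k - a k) (Nat.sub_le k (a k)) (M / (1 + Real.log (1 + (a k : ℝ)))) (fun _ => 1)
  simp only [mul_one] at h
  rw [h]
  have hl : 0 ≤ Real.log (1 + (a k : ℝ)) := Real.log_nonneg (by linarith [Nat.cast_nonneg (α := ℝ) (a k)])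
  exact div_le_self hM (by linarith)

/-- **THE PER-SCALE LOG-MOMENT IS EXACTLY `M`**: with `a(k) ≤ k`, `Σ_i λ k i·(1 + log(1 + (k − i))) = w_k·(1 + log(1 + a(k))) = M` — the
hypothesis `hM` of `RemainderExplicitHistoryLogMomentScale` ∕ `…Value` holds with equality at every scale. [folklore] -/
theorem scaleLogMoment_eq (hak : ∀ k, a k ≤ k) (k : ℕ) :
    ∑ i : Fin (k + 1), (if (i : ℕ) = k - a k then M / (1 + Real.log (1 + (a k : ℝ))) else 0) *
        (1 + Real.log (1 + ((k : ℝ) - (i : ℕ)))) = M := by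
  rw [sum_pointWeight k (k - a k) (Nat.sub_le k (a k)) _ (fun i : ℕ => 1 + Real.log (1 + ((k : ℝ) - i)))]
  have e : (k : ℝ) - ((k - a k : ℕ) : ℝ) = a k := by
    rw [Nat.cast_sub (hak k)]; ring
  rw [e]
  have hl : 0 < 1 + Real.log (1 + (a k : ℝ)) := by
    have : 0 ≤ Real.log (1 + (a k : ℝ)) := Real.log_nonneg (by linarith [Nat.cast_nonneg (α := ℝ) (a k)]); linarith
  field_simp

/-! ## §2 The lower iterated logarithm -/

/-- TELESCOPING STEP FROM BELOW: for `x ≥ 1`, `log(1 + log(x+1)) − log(1 + log x) ≤ 1∕(x·(1 + log x))` — `log y ≤ y − 1` twice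
(`log(B∕A) ≤ B∕A − 1 = (B − A)∕A`, `B − A = log(1 + 1∕x) ≤ 1∕x`). [folklore] -/
theorem logWeight_sub_le_inv_mul {x : ℝ} (hx : 1 ≤ x) :
    Real.log (1 + Real.log (x + 1)) - Real.log (1 + Real.log x) ≤ 1 / (x * (1 + Real.log x)) := by
  have hx0 : 0 < x := by linarith
  have hlx : 0 ≤ Real.log x := Real.log_nonneg hx
  have hlx1 : 0 ≤ Real.log (x + 1) := Real.log_nonneg (by linarith)
  set A : ℝ := 1 + Real.log x with hA
  set B : ℝ := 1 + Real.log (x + 1) with hB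
  have hA0 : 0 < A := by positivity
  have hBA : B - A ≤ 1 / x := by
    have e : B - A = Real.log ((x + 1) / x) := by rw [hA, hB, Real.log_div (by linarith) hx0.ne']; ring
    rw [e]
    have h := Real.log_le_sub_one_of_pos (show (0 : ℝ) < (x + 1) / x by positivity)
    have e2 : (x + 1) / x - 1 = 1 / x := by field_simp; ring
    linarith
  rw [show Real.log (1 + Real.log (x + 1)) - Real.log (1 + Real.log x) = Real.log (B / A) by
    rw [Real.log_div (by positivity : (0:ℝ) < B).ne' hA0.ne']]
  have h := Real.log_le_sub_one_of_pos (show (0 : ℝ) < B / A by positivity)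
  have e3 : B / A - 1 = (B - A) / A := by field_simp
  calc Real.log (B / A) ≤ (B - A) / A := by linarith
    _ ≤ (1 / x) / A := div_le_div_of_nonneg_right hBA hA0.le
    _ = 1 / (x * (1 + Real.log x)) := by rw [hA]; field_simp

/-- **THE LOWER ITERATED LOGARITHM**: for `c ≥ 1` and `m₀ ≤ N`:
`log(1 + log(c + N + 1)) − log(1 + log(c + m₀)) ≤ Σ_{m ∈ [m₀, N]} 1∕((c + m)(1 + log(c + m)))` (telescoping `logWeight_sub_le_inv_mul`). [folklore] -/
theorem sum_inv_mul_logWeight_ge {c : ℝ} (hc : 1 ≤ c) {m₀ N : ℕ} (hmN : m₀ ≤ N) :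
    Real.log (1 + Real.log (c + N + 1)) - Real.log (1 + Real.log (c + m₀)) ≤
      ∑ m ∈ Ico m₀ (N + 1), 1 / ((c + m) * (1 + Real.log (c + m))) := by
  have hstep : ∀ m ∈ Ico m₀ (N + 1), Real.log (1 + Real.log (c + ((m + 1 : ℕ) : ℝ))) - Real.log (1 + Real.log (c + m)) ≤
      1 / ((c + m) * (1 + Real.log (c + m))) := by
    intro m _
    push_cast
    rw [show c + ((m : ℝ) + 1) = c + m + 1 by ring]
    exact logWeight_sub_le_inv_mul (show (1 : ℝ) ≤ c + m by linarith [Nat.cast_nonneg (α := ℝ) m])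
  refine le_trans ?_ (sum_le_sum hstep)
  rw [sum_Ico_eq_sum_range]
  have htel := sum_range_sub (fun j : ℕ => Real.log (1 + Real.log (c + ((m₀ + j : ℕ) : ℝ)))) (N + 1 - m₀)
  have e : m₀ + (N + 1 - m₀) = N + 1 := by omega
  simp only [e, add_zero] at htel
  have hre : ∑ k ∈ range (N + 1 - m₀), (Real.log (1 + Real.log (c + ((m₀ + k + 1 : ℕ) : ℝ))) -
      Real.log (1 + Real.log (c + ((m₀ + k : ℕ) : ℝ)))) =
      Real.log (1 + Real.log (c + ((N + 1 : ℕ) : ℝ))) - Real.log (1 + Real.log (c + ((m₀ : ℕ) : ℝ))) := by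
    rw [← htel]
    refine sum_congr rfl fun j _ => ?_
    rw [show m₀ + (j + 1) = m₀ + j + 1 by omega]
  rw [hre]
  push_cast
  rw [show c + ((N : ℝ) + 1) = c + N + 1 by ring]

/-! ## §3 The deviation along a run of a selected length -/

/-- EVERY SCALE CONTRIBUTES `≥ 0`: along a run with `β ≥ b₀ > 0` at every step, `β¹_k(prefix) = g_k·w_k·(g_k − g_{k − a(k)}) ≥ 0`
(`run_mono`). [folklore] -/
theorem beta1_prefix_nonneg
    (hβ : ∀ (k : ℕ) (p : Fin (k + 1) → ℝ), β k p = b + p (Fin.last k) *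
      ∑ i : Fin (k + 1), (if (i : ℕ) = k - a k then M / (1 + Real.log (1 + (a k : ℝ))) else 0) * (p (Fin.last k) - p i))
    (S : B12Beta.OneLoopSplit β) (hS : ∀ k, S.β0 k = b) (hM : 0 ≤ M) {K : ℕ} {gs : ℕ → ℝ} {b₀ : ℝ}
    (h : RGEqH K β gs) (hpos : ∀ k, k ≤ K → 0 < gs k) (hb₀ : 0 < b₀) (hlo : ∀ j, j < K → b₀ ≤ β j (prefixOf gs j))
    {k : ℕ} (hk : k < K) : 0 ≤ S.β1 k (prefixOf gs k) := by
  rw [β1_eq (lam := fun k i => if i = k - a k then M / (1 + Real.log (1 + (a k : ℝ))) else 0) hβ S hS]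
  simp only [prefixOf_apply, Fin.val_last]
  rw [sum_pointWeight_sub k (k - a k) (Nat.sub_le k (a k))]
  have hsign : ∀ j, j < K → 0 ≤ β j (prefixOf gs j) := fun j hj => hb₀.le.trans (hlo j hj)
  have hle : gs (k - a k) ≤ gs k := run_mono h hpos hsign (Nat.sub_le k (a k)) hk.le
  have hl : 0 ≤ Real.log (1 + (a k : ℝ)) := Real.log_nonneg (by linarith [Nat.cast_nonneg (α := ℝ) (a k)])
  have hw : 0 ≤ M / (1 + Real.log (1 + (a k : ℝ))) := by positivity
  exact mul_nonneg (hpos k hk.le).le (mul_nonneg hw (by linarith))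

/-- **ON THE UPPER HALF OF A RUN OF A SELECTED LENGTH THE REMAINDER SEES THE OLDEST SCALE OF ITS WINDOW**: if `a(k) = K − k =: m` and
`β′·m ≥ P = 1∕g_K²` (run with `b∕2 ≤ β ≤ β′ = 3b∕2`), then
`β¹_k(prefix) ≥ (M∕24)∕((P + β′m)·(1 + log(1 + m)))` (`run_sub_ge`: displacement `≥ g_k·min(1, m·b₀·g_k²)∕4 ≥ g_k∕24`; `run_sq_ge`:
`g_k² ≥ 1∕(P + β′m)`). [folklore] -/
theorem beta1_prefix_ge_adaptive
    (hβ : ∀ (k : ℕ) (p : Fin (k + 1) → ℝ), β k p = b + p (Fin.last k) *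
      ∑ i : Fin (k + 1), (if (i : ℕ) = k - a k then M / (1 + Real.log (1 + (a k : ℝ))) else 0) * (p (Fin.last k) - p i))
    (S : B12Beta.OneLoopSplit β) (hS : ∀ k, S.β0 k = b) (hb : 0 < b) (hM : 0 ≤ M) {K : ℕ} {gs : ℕ → ℝ}
    (h : RGEqH K β gs) (hpos : ∀ k, k ≤ K → 0 < gs k)
    (hlo : ∀ j, j < K → b / 2 ≤ β j (prefixOf gs j)) (hup : ∀ j, j < K → β j (prefixOf gs j) ≤ 3 * b / 2)
    {k : ℕ} (hk : k < K) (hhalf : K ≤ 2 * k) (hak : a k = K - k) (hm : 1 / (gs K) ^ 2 ≤ 3 * b / 2 * ((K - k : ℕ) : ℝ)) :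
    M / 24 * (1 / ((1 / (gs K) ^ 2 + 3 * b / 2 * ((K - k : ℕ) : ℝ)) * (1 + Real.log (1 + ((K - k : ℕ) : ℝ))))) ≤
      S.β1 k (prefixOf gs k) := by
  have hgk := hpos k hk.le
  have hgK := hpos K le_rfl
  set m : ℕ := K - k with hmdef
  have hmk' : m ≤ k := by omega
  rw [β1_eq (lam := fun k i => if i = k - a k then M / (1 + Real.log (1 + (a k : ℝ))) else 0) hβ S hS]
  simp only [prefixOf_apply, Fin.val_last]
  rw [sum_pointWeight_sub k (k - a k) (Nat.sub_le k (a k)), hak]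
  set P : ℝ := 1 / (gs K) ^ 2 with hP
  have hP0 : 0 < P := by rw [hP]; positivity
  set β' : ℝ := 3 * b / 2 with hβ'
  have hβ'0 : 0 < β' := by positivity
  have hm0 : (0 : ℝ) ≤ (m : ℝ) := Nat.cast_nonneg m
  have hl : 0 ≤ Real.log (1 + (m : ℝ)) := Real.log_nonneg (by linarith)
  have hsub := run_sub_ge h hpos (half_pos hb) hlo (Nat.sub_le k m) hk.le
  have hsq := run_sq_ge h hpos hβ'0.le hup hk.le
  have em : ((K : ℝ) - k) = (m : ℝ) := by rw [hmdef, Nat.cast_sub hk.le]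
  rw [em] at hsq
  have eage : ((k : ℝ) - ((k - m : ℕ) : ℝ)) = (m : ℝ) := by rw [Nat.cast_sub hmk']; ring
  rw [eage] at hsub
  have hx : 1 / (P + β' * (m : ℝ)) ≤ (gs k) ^ 2 := hsq
  have hmin : (1 : ℝ) / 6 ≤ min 1 ((m : ℝ) * (b / 2) * (gs k) ^ 2) := by
    refine le_min (by norm_num) ?_
    have hβa : 0 < P + β' * (m : ℝ) := by positivity
    have h6 : (1 : ℝ) / 6 ≤ (m : ℝ) * (b / 2) * (1 / (P + β' * (m : ℝ))) := by
      rw [hβ'] at hm hβa ⊢; rw [← mul_div_assoc, mul_one, le_div_iff₀ hβa]; nlinarith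
    exact h6.trans (mul_le_mul_of_nonneg_left hx (by positivity))
  have hw : M / (1 + Real.log (1 + (m : ℝ))) * (1 / 24) * (1 / (P + β' * (m : ℝ))) =
      M / 24 * (1 / ((P + β' * (m : ℝ)) * (1 + Real.log (1 + (m : ℝ))))) := by field_simp
  rw [← hw]
  have hwnn : 0 ≤ M / (1 + Real.log (1 + (m : ℝ))) := by positivity
  have hdisp : gs k * (1 / 6) / 4 ≤ gs k - gs (k - m) := by
    have := mul_le_mul_of_nonneg_left hmin hgk.le
    linarith
  calc M / (1 + Real.log (1 + (m : ℝ))) * (1 / 24) * (1 / (P + β' * (m : ℝ)))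
      ≤ M / (1 + Real.log (1 + (m : ℝ))) * (1 / 24) * (gs k) ^ 2 := mul_le_mul_of_nonneg_left hx (by positivity)
    _ = gs k * (M / (1 + Real.log (1 + (m : ℝ))) * (gs k * (1 / 6) / 4)) := by ring
    _ ≤ gs k * (M / (1 + Real.log (1 + (m : ℝ))) * (gs k - gs (k - m))) :=
        mul_le_mul_of_nonneg_left (mul_le_mul_of_nonneg_left hdisp hwnn) hgk.le

/-- **THE DEVIATION GROWS LIKE AN ITERATED LOGARITHM ALONG RUNS OF THE SELECTED LENGTHS.**  For the adaptive family (`b > 0`, `M ≥ 0`,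
`γ > 0`, `2Mγ² ≤ b`, `a(k) ≤ k`) along a run of (0.20) in the box with `K` steps such that `a(k) = K − k` whenever `K ≤ 2k < 2K`, and any
`m₀ ≥ 1` with `β′m₀ ≥ P` (`P = 1∕g_K²`, `β′ = 3b∕2`) and `2m₀ ≤ K`:
`(M∕(36b))·(log(1 + log(P∕β′ + 1 + ⌊K∕2⌋ + 1)) − log(1 + log(P∕β′ + 1 + m₀))) ≤ 1∕g_0² − 1∕g_K² − K·b`. [folklore] -/
theorem deviation_ge_loglog
    (hβ : ∀ (k : ℕ) (p : Fin (k + 1) → ℝ), β k p = b + p (Fin.last k) *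
      ∑ i : Fin (k + 1), (if (i : ℕ) = k - a k then M / (1 + Real.log (1 + (a k : ℝ))) else 0) * (p (Fin.last k) - p i))
    (S : B12Beta.OneLoopSplit β) (hS : ∀ k, S.β0 k = b) (hb : 0 < b) (hM : 0 ≤ M) (hγ : 0 < γ) (hsmall : 2 * M * γ ^ 2 ≤ b)
    {K : ℕ} {gs : ℕ → ℝ} (h : RGEqH K β gs) (hbox : ∀ k, k ≤ K → 0 < gs k ∧ gs k ≤ γ)
    (hsel : ∀ k, K ≤ 2 * k → k < K → a k = K - k) {m₀ : ℕ} (hm₀1 : 1 ≤ m₀)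
    (hm₀ : 1 / (gs K) ^ 2 ≤ 3 * b / 2 * (m₀ : ℝ)) (hKm : 2 * m₀ ≤ K) :
    M / (36 * b) * (Real.log (1 + Real.log (1 / (gs K) ^ 2 / (3 * b / 2) + 1 + ((K / 2 : ℕ) : ℝ) + 1)) -
        Real.log (1 + Real.log (1 / (gs K) ^ 2 / (3 * b / 2) + 1 + (m₀ : ℝ)))) ≤
      1 / (gs 0) ^ 2 - 1 / (gs K) ^ 2 - (K : ℝ) * b := by
  have hpos : ∀ k, k ≤ K → 0 < gs k := fun k hk => (hbox k hk).1
  have hgK := hpos K le_rfl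
  have hlam0 : ∀ (k : ℕ) (i : Fin (k + 1)), 0 ≤ (fun k i => if i = k - a k then M / (1 + Real.log (1 + (a k : ℝ))) else 0) k i :=
    fun k i => pointWeight_nonneg hM k i
  have hlamW : ∀ k, ∑ i : Fin (k + 1), (fun k i => if i = k - a k then M / (1 + Real.log (1 + (a k : ℝ))) else 0) k i ≤ M :=
    fun k => sum_pointWeight_le hM k
  have hlo : ∀ j, j < K → b / 2 ≤ β j (prefixOf gs j) := fun j hj =>
    lower (lam := fun k i => if i = k - a k then M / (1 + Real.log (1 + (a k : ℝ))) else 0) hβ hlam0 hlamW hγ hsmall j _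
      (prefixOf_mem_box hj.le hbox)
  have hup : ∀ j, j < K → β j (prefixOf gs j) ≤ 3 * b / 2 := fun j hj =>
    upper (lam := fun k i => if i = k - a k then M / (1 + Real.log (1 + (a k : ℝ))) else 0) hβ hlam0 hlamW hγ hsmall j _
      (prefixOf_mem_box hj.le hbox)
  set P : ℝ := 1 / (gs K) ^ 2 with hP
  have hP0 : 0 < P := by rw [hP]; positivity
  set β' : ℝ := 3 * b / 2 with hβ'
  have hβ'0 : 0 < β' := by positivity
  set c : ℝ := P / β' + 1 with hc
  have hPβ : 0 ≤ P / β' := by positivity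
  have hc1 : 1 ≤ c := by linarith
  set N : ℕ := K / 2 with hN
  have hNm : m₀ ≤ N := by omega
  have hNK : N ≤ K := Nat.div_le_self K 2
  have hnn : ∀ k ∈ range K, 0 ≤ S.β1 k (prefixOf gs k) := fun k hk =>
    beta1_prefix_nonneg hβ S hS hM h hpos (half_pos hb) hlo (mem_range.1 hk)
  have h1 : ∑ j ∈ range N, S.β1 (K - 1 - j) (prefixOf gs (K - 1 - j)) ≤ 1 / (gs 0) ^ 2 - 1 / (gs K) ^ 2 - (K : ℝ) * b := by
    rw [deviation_eq S hS h, ← sum_range_reflect _ K]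
    refine sum_le_sum_of_subset_of_nonneg (range_mono hNK) fun j hj _ => ?_
    exact hnn _ (mem_range.2 (by have := mem_range.1 hj; omega))
  have h2 : ∀ j ∈ Ico (m₀ - 1) N, M / (24 * β') * (1 / ((c + ((j + 1 : ℕ) : ℝ)) * (1 + Real.log (c + ((j + 1 : ℕ) : ℝ))))) ≤
      S.β1 (K - 1 - j) (prefixOf gs (K - 1 - j)) := by
    intro j hj
    have hj := mem_Ico.1 hj
    obtain ⟨hk, hhalf, em⟩ : K - 1 - j < K ∧ K ≤ 2 * (K - 1 - j) ∧ K - (K - 1 - j) = j + 1 := ⟨by omega, by omega, by omega⟩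
    have hak : a (K - 1 - j) = K - (K - 1 - j) := hsel _ hhalf hk
    have hmj : 1 / (gs K) ^ 2 ≤ 3 * b / 2 * ((K - (K - 1 - j) : ℕ) : ℝ) := by
      rw [em]
      refine hm₀.trans (mul_le_mul_of_nonneg_left (by exact_mod_cast (by omega : m₀ ≤ j + 1)) (by positivity))
    have hmain := beta1_prefix_ge_adaptive hβ S hS hb hM h hpos hlo hup hk hhalf hak hmj
    rw [em] at hmain
    refine le_trans ?_ hmain
    have hm1 : (1 : ℝ) ≤ ((j + 1 : ℕ) : ℝ) := by exact_mod_cast (by omega : 1 ≤ j + 1)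
    set m : ℝ := ((j + 1 : ℕ) : ℝ)
    have hlm : 0 ≤ Real.log (1 + m) := Real.log_nonneg (by linarith)
    have hlcm : 0 ≤ Real.log (c + m) := Real.log_nonneg (by linarith)
    have hD1 : 0 < (P + β' * m) * (1 + Real.log (1 + m)) := by positivity
    have hcmp : (P + β' * m) * (1 + Real.log (1 + m)) ≤ β' * ((c + m) * (1 + Real.log (c + m))) := by
      have h1' : P + β' * m ≤ β' * (c + m) := by
        rw [hc]; have : β' * (P / β') = P := by field_simp
        linarith
      have h2' : Real.log (1 + m) ≤ Real.log (c + m) := Real.log_le_log (by linarith) (by linarith)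
      calc (P + β' * m) * (1 + Real.log (1 + m)) ≤ (β' * (c + m)) * (1 + Real.log (1 + m)) :=
            mul_le_mul_of_nonneg_right h1' (by linarith)
        _ ≤ (β' * (c + m)) * (1 + Real.log (c + m)) := mul_le_mul_of_nonneg_left (by linarith) (by positivity)
        _ = β' * ((c + m) * (1 + Real.log (c + m))) := by ring
    rw [show (1 : ℝ) / (gs K) ^ 2 = P from rfl, show (3 : ℝ) * b / 2 = β' from rfl]
    calc M / (24 * β') * (1 / ((c + m) * (1 + Real.log (c + m))))
        = M / 24 * (1 / (β' * ((c + m) * (1 + Real.log (c + m))))) := by field_simp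
      _ ≤ M / 24 * (1 / ((P + β' * m) * (1 + Real.log (1 + m)))) :=
          mul_le_mul_of_nonneg_left (one_div_le_one_div_of_le hD1 hcmp) (by positivity)
  have h3 : ∑ j ∈ Ico (m₀ - 1) N, M / (24 * β') * (1 / ((c + ((j + 1 : ℕ) : ℝ)) * (1 + Real.log (c + ((j + 1 : ℕ) : ℝ))))) ≤
      ∑ j ∈ range N, S.β1 (K - 1 - j) (prefixOf gs (K - 1 - j)) := by
    refine (sum_le_sum h2).trans ?_
    refine sum_le_sum_of_subset_of_nonneg (fun j hj => mem_range.2 (mem_Ico.1 hj).2) fun j hj _ => ?_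
    exact hnn _ (mem_range.2 (by have := mem_range.1 hj; omega))
  have h4 : ∑ j ∈ Ico (m₀ - 1) N, M / (24 * β') * (1 / ((c + ((j + 1 : ℕ) : ℝ)) * (1 + Real.log (c + ((j + 1 : ℕ) : ℝ))))) =
      M / (24 * β') * ∑ m ∈ Ico m₀ (N + 1), 1 / ((c + (m : ℝ)) * (1 + Real.log (c + (m : ℝ)))) := by
    rw [mul_sum]
    have e : Ico m₀ (N + 1) = (Ico (m₀ - 1) N).image (fun j => j + 1) := by
      ext m; simp only [mem_Ico, mem_image]; constructor
      · intro hm; exact ⟨m - 1, ⟨by omega, by omega⟩, by omega⟩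
      · rintro ⟨j, hj, rfl⟩; omega
    rw [e, sum_image (fun x _ y _ hxy => by omega)]
  have h5 := mul_le_mul_of_nonneg_left (sum_inv_mul_logWeight_ge hc1 hNm) (by positivity : 0 ≤ M / (24 * β'))
  have e36 : M / (36 * b) = M / (24 * β') := by rw [hβ']; field_simp; ring
  rw [e36]
  calc M / (24 * β') * (Real.log (1 + Real.log (P / β' + 1 + ((N : ℕ) : ℝ) + 1)) - Real.log (1 + Real.log (P / β' + 1 + (m₀ : ℝ))))
      = M / (24 * β') * (Real.log (1 + Real.log (c + N + 1)) - Real.log (1 + Real.log (c + m₀))) := by rw [hc]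
    _ ≤ M / (24 * β') * ∑ m ∈ Ico m₀ (N + 1), 1 / ((c + (m : ℝ)) * (1 + Real.log (c + (m : ℝ)))) := h5
    _ = _ := h4.symm
    _ ≤ _ := h3
    _ ≤ _ := h1

/-! ## §4 END: a bounded per-scale log-moment does not give a K-uniform envelope -/

/-- **PER-SCALE LOG-MOMENT `M` AT EVERY SCALE, YET NO K-UNIFORM TWO-LOOP ENVELOPE.**  For the adaptive family (`b, M > 0`, `γ > 0`,
`2Mγ² ≤ b`; age map `a(k) ≤ k` equal to `K − k` on the upper half of every run length `K` of an unbounded set) and every renormalized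
`g ∈ ]0,γ]`: there is NO `Q′` with `|1∕(gs 0)² − 1∕g² − K·b| ≤ Q′` over the family's runs of (0.20) in the box ending at `g` — although
(`scaleLogMoment_eq`) the hypothesis `hM` of `RemainderExplicitHistoryLogMomentScale` ∕ `…Value` holds with EQUALITY at every scale, the
diagonal is two-loop free and (AF-1) holds.  The companions' `O(log log K)` envelope and VALUE statement are therefore the most a
per-scale log-moment buys. [folklore] -/
theorem scaleLogMoment_not_sufficient_for_envelope
    (hβ : ∀ (k : ℕ) (p : Fin (k + 1) → ℝ), β k p = b + p (Fin.last k) *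
      ∑ i : Fin (k + 1), (if (i : ℕ) = k - a k then M / (1 + Real.log (1 + (a k : ℝ))) else 0) * (p (Fin.last k) - p i))
    (hb : 0 < b) (hM : 0 < M) (hγ : 0 < γ) (hsmall : 2 * M * γ ^ 2 ≤ b)
    (hsel : ∀ N : ℕ, ∃ K : ℕ, N ≤ K ∧ ∀ k, K ≤ 2 * k → k < K → a k = K - k) {g : ℝ} (hg : 0 < g) (hgγ : g ≤ γ) :
    ¬ ∃ Q' : ℝ, ∀ (K : ℕ) (gs : ℕ → ℝ), RGEqH K β gs → (∀ k, k ≤ K → 0 < gs k ∧ gs k ≤ γ) → gs K = g →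
      |1 / (gs 0) ^ 2 - 1 / g ^ 2 - (K : ℝ) * b| ≤ Q' := by
  rintro ⟨Q', hQ'⟩
  obtain ⟨S, hS⟩ := exists_split (lam := fun k i => if i = k - a k then M / (1 + Real.log (1 + (a k : ℝ))) else 0) hβ
  have hlam0 : ∀ (k : ℕ) (i : Fin (k + 1)), 0 ≤ (fun k i => if i = k - a k then M / (1 + Real.log (1 + (a k : ℝ))) else 0) k i :=
    fun k i => pointWeight_nonneg hM.le k i
  have hlamW : ∀ k, ∑ i : Fin (k + 1), (fun k i => if i = k - a k then M / (1 + Real.log (1 + (a k : ℝ))) else 0) k i ≤ M :=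
    fun k => sum_pointWeight_le hM.le k
  set P : ℝ := 1 / g ^ 2 with hP
  have hP0 : 0 < P := by rw [hP]; positivity
  set β' : ℝ := 3 * b / 2 with hβ'
  have hβ'0 : 0 < β' := by positivity
  set m₀ : ℕ := ⌈P / β'⌉₊ + 1 with hm₀def
  have hm₀1 : 1 ≤ m₀ := by omega
  have hm₀P : P ≤ β' * (m₀ : ℝ) := by
    have h1 : P / β' ≤ (⌈P / β'⌉₊ : ℝ) := Nat.le_ceil _
    have h2 : (⌈P / β'⌉₊ : ℝ) ≤ (m₀ : ℝ) := by rw [hm₀def]; push_cast; linarith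
    rw [div_le_iff₀ hβ'0] at h1
    nlinarith
  set c : ℝ := P / β' + 1 with hc
  set T : ℝ := 36 * b / M * (Q' + 1) + Real.log (1 + Real.log (c + (m₀ : ℝ))) with hT
  set E : ℕ := ⌈Real.exp (Real.exp T)⌉₊ with hE
  obtain ⟨K, hKN, hselK⟩ := hsel (2 * E + 2 * m₀)
  obtain ⟨hKm, hNE⟩ : 2 * m₀ ≤ K ∧ E ≤ K / 2 := ⟨by omega, by omega⟩
  obtain ⟨gs, hend, h, hbox⟩ :=
    runs_exist (lam := fun k i => if i = k - a k then M / (1 + Real.log (1 + (a k : ℝ))) else 0) hβ hb hlam0 hlamW hγ hsmall K hg hgγ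
  have hm₀' : 1 / (gs K) ^ 2 ≤ 3 * b / 2 * (m₀ : ℝ) := by rw [hend]; exact hm₀P
  have hdev := deviation_ge_loglog hβ S hS hb hM.le hγ hsmall h hbox hselK hm₀1 hm₀' hKm
  rw [hend, ← hP, ← hβ', ← hc] at hdev
  have hbound := (abs_le.1 (hQ' K gs h hbox hend)).2
  have hPβ : 0 ≤ P / β' := by positivity
  have hc1 : 1 ≤ c := by linarith
  have hbig : T ≤ Real.log (1 + Real.log (c + ((K / 2 : ℕ) : ℝ) + 1)) := by
    have hE1 : Real.exp (Real.exp T) ≤ (E : ℝ) := Nat.le_ceil _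
    have hE2 : (E : ℝ) ≤ ((K / 2 : ℕ) : ℝ) := by exact_mod_cast hNE
    have hx : Real.exp (Real.exp T) ≤ c + ((K / 2 : ℕ) : ℝ) + 1 := by linarith
    have hl1 : Real.exp T ≤ Real.log (c + ((K / 2 : ℕ) : ℝ) + 1) := by
      rw [← Real.log_exp (Real.exp T)]; exact Real.log_le_log (Real.exp_pos _) hx
    calc T = Real.log (Real.exp T) := (Real.log_exp T).symm
      _ ≤ _ := Real.log_le_log (Real.exp_pos T) (by linarith)
  have hcoef : 0 < M / (36 * b) := by positivity
  have key : Q' + 1 ≤ 1 / (gs 0) ^ 2 - P - (K : ℝ) * b := by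
    have hstep : M / (36 * b) * (T - Real.log (1 + Real.log (c + (m₀ : ℝ)))) ≤ 1 / (gs 0) ^ 2 - P - (K : ℝ) * b := by
      refine le_trans (mul_le_mul_of_nonneg_left ?_ hcoef.le) hdev
      rw [hc]; linarith
    have e : M / (36 * b) * (T - Real.log (1 + Real.log (c + (m₀ : ℝ)))) = Q' + 1 := by
      rw [hT]; field_simp; ring
    linarith
  linarith

/-- **THE HYPOTHESES ON THE AGE MAP ARE INHABITED** (dyadic ages): `a(k) = 2^{⌊log₂ k⌋ + 1} − k` for `k ≥ 1` (`a(0) = 0`) has `a(k) ≤ k`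
and equals `K − k` on the upper half of every run length `K = 2^{j+1}`. [folklore] -/
theorem age_map_exists : ∃ a : ℕ → ℕ, (∀ k, a k ≤ k) ∧ ∀ N : ℕ, ∃ K : ℕ, N ≤ K ∧ ∀ k, K ≤ 2 * k → k < K → a k = K - k := by
  refine ⟨fun k => if k = 0 then 0 else 2 ^ (Nat.log 2 k + 1) - k, fun k => ?_, fun N => ⟨2 ^ (N + 1), ?_, fun k hk1 hk2 => ?_⟩⟩
  · show (if k = 0 then 0 else 2 ^ (Nat.log 2 k + 1) - k) ≤ k
    by_cases hk : k = 0
    · simp [hk]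
    · rw [if_neg hk]
      have := Nat.pow_log_le_self 2 hk
      rw [pow_succ]; omega
  · calc N ≤ 2 ^ N := Nat.lt_two_pow_self.le
      _ ≤ 2 ^ (N + 1) := Nat.pow_le_pow_right (by norm_num) (by omega)
  · have hk0 : k ≠ 0 := by rintro rfl; simp at hk1
    dsimp only
    rw [if_neg hk0]
    have hlog : Nat.log 2 k = N := by
      refine Nat.log_eq_of_pow_le_of_lt_pow ?_ ?_
      · rw [pow_succ] at hk1; omega
      · exact hk2
    rw [hlog]

end Summit.QuantumFields.BalabanUV.Beta.RemainderExplicitHistoryLogMomentScaleSharp
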